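import Mathlib.Algebra.Group.Subgroup.Ker
import Literature.Topology.FourManifolds.GroupTrisections
import Summits.SmoothPoincare4.SmoothPoincare4.Theorems.CongruenceShadowsShadowsStandardStubFaceCharOfTrisection
import Summits.SmoothPoincare4.SmoothPoincare4.Theorems.CongruenceShadowsShadowsStandardStubFaceEuclid
import Summits.SmoothPoincare4.SmoothPoincare4.Theorems.CongruenceShadowsShadowsStandardStubKerFaceChar
import HarnessLib

/-!
# Stub `stub_faceNormalFormGenusThree` of line `power-twist-absorption` for crux `CongruenceShadows.ShadowsStandard`
(item stmt-SmoothPoincare4-14593, route route-SmoothPoincare4-CongruenceShadows)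

**The face normal form at genus 3.** Let `S₃ = ⟨a₁,b₁,a₂,b₂,a₃,b₃ ∣ ∏[aᵢ,bᵢ]⟩` and let
`N = (N₀, N₁, N₂) = s4Kernels` be the kernel triple of the standard genus-`3` trisection of `S⁴`
(`N₀ = ⟪a₁,a₂,b₃⟫`, `N₁ = ⟪a₁,b₂,a₃⟫`, `N₂ = ⟪b₁,a₂,a₃⟫`). For every `(3;1)` group trisection
`K = (N₀, N₁, K₂)` of the trivial group whose first two kernels are the standard ones
(Waldhausen-normalised), there is an automorphism `χ` of `S₃` stabilising `N₀` AND `N₁` — an exact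
element of the Goeritz group of the standard genus-`3` Heegaard splitting of `S¹ × S²` — with
`χ(N₂ ⊔ N₀) = K₂ ⊔ N₀`: seen from inside the first handlebody (`F₃ = S₃ ⧸ N₀ = π₁(H₀)`), the image
of the third kernel of a genus-`3` trisection of a homotopy `4`-sphere is standard.

Assembly of three landed pieces: `stub_faceCharOfTrisection` (the pair axiom
`S ⧸ (N₀ ⊔ K₂) ≅ ℤ` and the triple axiom give a surjective character `f : S₃ → ℤ` killing `N₀`
with `ker f = K₂ ⊔ N₀` and `N₁ ⊔ ker f = ⊤`, i.e. coprime values on `b₂, a₃`),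
`stub_faceEuclid` (the Euclidean algorithm realised by the Goeritz elements `σ₂₃, S₁, S₂` carries
`f` to `±` the standard face character `χ_{b₂}`), `stub_kerFaceChar` (`ker χ_{b₂}^{±1} = N₂ ⊔ N₀`).
This is step (i) of the idea card `luft-twist-normal-form` and the `m = 0`, exact form of Stubs 1+2
of line `finitary-ac-central-residue`, made unconditional; it reduces the genus-`3` rung of the
line's gate (and the genus-`3` case of the crux) to third kernels with `K₂N₀ = N₂N₀`. [folklore]
-/

-- the prescribed namespace `Summit.<P>.<Sub>.…` duplicates `SmoothPoincare4` (P = Sub)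
set_option linter.dupNamespace false

noncomputable section

namespace Summit.SmoothPoincare4.SmoothPoincare4.Theorems.ShadowsStandard.PowerTwistAbsorption

open Literature.Topology.FourManifolds Subgroup

/-- **Face normal form at genus 3.** For every Waldhausen-normalised `(3;1)` group trisection
`(N₀, N₁, K₂)` of the trivial group there is an exact Goeritz element `χ ∈ Stab N₀ ∩ Stab N₁` of
the standard genus-`3` pair with `χ(N₂ ⊔ N₀) = K₂ ⊔ N₀` (the `H₀`-face of a genus-`3` trisection of
a homotopy `4`-sphere is standard). [folklore] -/
theorem stub_faceNormalFormGenusThree :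
    ∀ K : TrisectionKernels 3, IsGroupTrisection 3 1 (PUnit : Type) K →
      K 0 = s4Kernels 0 → K 1 = s4Kernels 1 →
      ∃ χ : SurfaceGroup 3 ≃* SurfaceGroup 3,
        (s4Kernels 0).map χ.toMonoidHom = s4Kernels 0 ∧ (s4Kernels 1).map χ.toMonoidHom = s4Kernels 1 ∧
        (s4Kernels 2 ⊔ s4Kernels 0).map χ.toMonoidHom = K 2 ⊔ s4Kernels 0 := by
  intro K hK h0 h1
  obtain ⟨f, fa0, fa1, fb2, hsurj, hN1, hker⟩ := stub_faceCharOfTrisection K hK h0 h1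
  obtain ⟨χ, hχ0, hχ1, ga0, ga1, ga2, gb0, gb2, gb1⟩ := stub_faceEuclid f fa0 fa1 fb2 hsurj hN1
  have hker' : (f.comp χ.toMonoidHom).ker = s4Kernels 2 ⊔ s4Kernels 0 :=
    stub_kerFaceChar (f.comp χ.toMonoidHom) ga0 ga1 ga2 gb0 gb2 gb1
  refine ⟨χ, hχ0, hχ1, ?_⟩
  rw [← hker, ← hker', ← MonoidHom.comap_ker]
  exact Subgroup.map_comap_eq_self_of_surjective (f := χ.toMonoidHom) χ.surjective _

end Summit.SmoothPoincare4.SmoothPoincare4.Theorems.ShadowsStandard.PowerTwistAbsorption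

end
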